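import Summits.QuantumFields.BalabanUV.Beta.FP.PerfectTelescopingFinite

/-!
# `BalabanUV.Beta.FP.PerfectTelescopingFiniteComposite` — road «FP» for binder row D1, leaf N7 ∕ sub-row **MS-1-FIN** (companion): THE
# DECIMATED COMPOSITE READ ON THE STEP-`j` LATTICE — `dec (Lc^j) [KInv_N ∘ liftW N (KInvStep Lc (j+m)) ∘ KInv_N] = ((Lc^j)^(d+2))² ·
# [KTot_{j,m} ∘ liftW (Lc^m) (KInvStep Lc (j+m)) ∘ KTot_{j,m}]` on the field–field block (`N = Lc^(j+m)`), hence the finite-level (MS-1) of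
# `PerfectTelescopingFinite.kTot_pair_telescoping` with the composite THROUGH THE NEXT ONE STEP written over the (j, m)-resolvents themselves

HONEST FRAMING (cell contract, verbatim): «discharging `BetaPertH` makes Bałaban's UV stability UNCONDITIONAL — a real constructive-QFT
result; it is NOT the continuum limit and NOT the Clay problem.»  HONEST DEPENDENCY (verbatim): «continuum YM on T⁴ ⇐ BetaPertH ∧ nine
spine estimates (0/9 proved); BetaPertH ⇐ (D1) ∧ (D4) ∧ CAP+tail; G-an2-4 gates asym, D1 and NE2/3/4.»  THIS MODULE DISCHARGES NOTHING of
the wall: [folklore] kernel bookkeeping (sublattice re-indexing of `tsum`s, exchange of FINITE leg sums with absolutely convergent coarse sums)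
composed BY NAME from an5's `ResolventCompositionStepB.compA_apply` ∕ `KInvStep_inl_inl` ∕ `GQ_bdd` ∕ `abs_tsum_finsum_mul_le`,
`ResolventComposition.tsum_sublattice₀` ∕ `GamΦ_eq_neg_wH` ∕ `summable_wH_sub_zsmul` ∕ `dec_inr_inl`, `StepDriftWitness.dec_inl_inr`,
`OneStepResolventKernel.KInv_inl_inr_coarse` ∕ `KInv_inr_inl_coarse`, an2's `InterLevelTransport.liftW` pins, and road FP's `PerfectObjects.KTot`.
No `def`, no `Prop` minted, nothing cited, no hypothesis is a printed statement, 0 sorry.  0 wall binders; NOT `hasym`, NOT D1, NOT `BetaPertH`,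
NOT continuum, NOT Clay.

ABSOLUTE RULE (cell charter, verbatim): «No internally-minted statement may enter as a cited fact. Every hypothesis is either kernel-proved
in this package or a verbatim quotation of a PUBLISHED theorem with page reference. The manuscript(s) under audit are NOT citable for their
own disputed steps — they are the thing under adjudication; programme-internal (2001/route/tribunal) claims are never citable.»

WHY (road FP owner d1-p3-g3's N7 PLAN v1 §2 (MS-1): «Γ_{Lc^{m+1}} = Γ_{Lc^m} + Σ H_{Lc^m} · C^{[Lc^m]} · H_{Lc^m}ᵀ … C^{[N]} := N^{−p_C}·C((u−u′)/N) …
the exponent is fixed by `unitK`, to be read off, not asserted»).  `PerfectTelescopingFinite.kTot_pair_telescoping` leaves the correction term as the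
`Lc^j`-decimation of an5's FINE composite `KInv_N ∘ liftW N true true (KInvStep Lc (j+m)) ∘ KInv_N` (`N = Lc^(j+m)`).  Here that decimated
composite is identified, ENTRY BY ENTRY on the field–field block, with the composite of the (j, m)-resolvents `KTot N (Lc^j)` themselves through
the weighted lift BY `Lc^m` (step-`j` coordinates) of THE NEXT ONE STEP `KInvStep Lc (j+m)` (the (j+m, 1)-member), times the explicit scalar
`((Lc^j)^(d+2))²` — the square of the field-slot unit factor, i.e. exactly what the road's `unitK` rescaling of the MULTIPLIER legs absorbs
at the limit (`HessKerDressedUnits`; not touched here).  With it the finite-level (MS-1) reads, for co-closed finitely supported `G, G′`: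
`⟨G, Γ_{(j,m+1)} G′⟩ = ⟨G, Γ_{(j,m)} G′⟩ − ((Lc^j)^(d+2))²·⟨G, [KTot_{j,m} ∘ liftW (Lc^m) tt (KInvStep Lc (j+m)) ∘ KTot_{j,m}]_ff G′⟩`
(`kTot_pair_telescoping_step`) — «Γ_{(j,m+1)} = Γ_{(j,m)} + H_{(j,m)} C H_{(j,m)}ᵀ» at every finite `j` (the sign: the `(inr, inl)` block
of a packed resolvent is MINUS the transposed minimiser, `ℋ♭ = −ℋᵀ`).  The passage `j → ∞` (MS-1 proper) is NOT done here.

CONTENT (all [folklore]; general `d`, any `Lc ≥ 1`).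
* §1 `finsum_tsum_comm₁` (a finite weighted sum through an absolutely convergent coarse sum), `zsmul_pow_mul`, `KTot_inl_inr_zsmul` ∕
  `KTot_inr_inl_zsmul` (the mixed blocks of the (j, m)-resolvent at an `Lc^m`-coarse argument: `±(Lc^j)^{−(d+2)}`× the leg sum of `wH_N`).
* §2 `comp_liftW_comp_apply` (GENERIC: `[A ∘ liftW P s t S ∘ B](x, y; a, b)` as a double coarse sum — an5's `compA_apply` skeleton for arbitrary
  kernels), **`dec_compA_apply`** (the decimated fine composite in closed form), **`dec_compA_eq_comp_KTot`** (= `((Lc^j)^(d+2))²`· the step-`j`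
  composite, field–field block), `comp_KTot_liftW_apply` (the step-`j` composite as «−H C Hᵀ» with both outer factors the `(inl, inr)` block).
* §3 **`kTot_pair_telescoping_step`** — the finite-level (MS-1) with the composite over the (j, m)-resolvents.
Unit `b2b-balaban-gan24-formalise-leaf-05` (gen 33; cross-lane idle G-an2-4 swarm leaf seat on road FP's sub-row MS-1-FIN).
-/

noncomputable section

namespace Summit.QuantumFields.BalabanUV.Beta.FP.PerfectTelescopingFiniteComposite

open Finset
open scoped BigOperators
open Literature.Probability.LatticeModels (TorusSite Torus.proj)
open Literature.MathematicalPhysics.QuantumFieldTheory.Balaban1983to89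
open Literature.MathematicalPhysics.QuantumFieldTheory.Balaban1983to89.Beta
open AffineAveraging (Form1 codiff₁)
open ExpKernelCalculus (MKer comp)
open KernelSpecInstance (wH)
open OneStepResolventKernel (Fib KInv KInv_inl_inr_coarse KInv_inr_inl_coarse)
open OneStepKernelFamily (dec legPt legW legSet LegIdx KInvStep)
open InterLevelTransport (liftW slotW liftW_zsmul liftW_inl_left liftW_inl_right liftW_off slotW_true)
open KKTFluctuationEnergy (summable_mul_of_bdd summable_mul_of_bdd')
open ResolventComposition (tsum_sublattice₀ GamΦ_eq_neg_wH summable_wH_sub_zsmul dec_inr_inl slot_true)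
open ResolventCompositionStepB (compA_apply KInvStep_inl_inl GQ GQ_bdd abs_tsum_finsum_mul_le l1n)
open StepDriftWitness (dec_inl_inr)
open Summit.QuantumFields.BalabanUV.Beta.FP.PerfectObjects (KTot KTot_def)
open Summit.QuantumFields.BalabanUV.Beta.FP.PerfectTelescopingFinite (kTot_pair_telescoping)

variable {d : ℕ}

/-! ## §1 Exchange of finite leg sums with coarse sums; the mixed blocks of the (j, m)-resolvent at coarse arguments -/

/-- [folklore] A finite weighted sum passes through an absolutely convergent coarse sum of finitely many summands. -/
theorem finsum_tsum_comm₁ {α β : Type*} (s : Finset α) (J : Finset β) (a : α → ℝ)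
    (f : α → β → (Fin (d + 1) → ℤ) → ℝ) (hf : ∀ y, ∀ ν ∈ J, Summable (f y ν)) :
    ∑ y ∈ s, a y * ∑' w, ∑ ν ∈ J, f y ν w = ∑' w, ∑ ν ∈ J, ∑ y ∈ s, a y * f y ν w := by
  have hs1 : ∀ y, Summable fun w => ∑ ν ∈ J, a y * f y ν w :=
    fun y => summable_sum fun ν hν => (hf y ν hν).mul_left (a y)
  symm
  calc ∑' w, ∑ ν ∈ J, ∑ y ∈ s, a y * f y ν w
      = ∑' w, ∑ y ∈ s, ∑ ν ∈ J, a y * f y ν w := tsum_congr fun w => Finset.sum_comm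
    _ = ∑ y ∈ s, ∑' w, ∑ ν ∈ J, a y * f y ν w := Summable.tsum_finsetSum fun y _ => hs1 y
    _ = ∑ y ∈ s, a y * ∑' w, ∑ ν ∈ J, f y ν w := by
        refine Finset.sum_congr rfl fun y _ => ?_
        rw [← tsum_mul_left]
        exact tsum_congr fun w => (Finset.mul_sum _ _ _).symm

/-- [folklore] Cast bookkeeping: `Lc^j • (Lc^m • z) = Lc^(j+m) • z`. -/
theorem zsmul_pow_mul (Lc j m : ℕ) (z : Fin (d + 1) → ℤ) :
    ((Lc ^ j : ℕ) : ℤ) • (((Lc ^ m : ℕ) : ℤ) • z) = ((Lc ^ (j + m) : ℕ) : ℤ) • z := by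
  rw [smul_smul, ← Nat.cast_mul, ← pow_add]

variable (Lc : ℕ) [NeZero Lc]

/-- [folklore] **THE `(inl, inr)` BLOCK OF THE (j, m)-RESOLVENT AT AN `Lc^m`-COARSE SECOND ARGUMENT**: `(Lc^j)^{−(d+2)}` times the leg sum of the
level-`Lc^(j+m)` minimiser column (`dec_inl_inr`, `KInv_inl_inr_coarse`). -/
theorem KTot_inl_inr_zsmul (j m : ℕ) (κ μ : Fin (d + 1)) (x' z' : Fin (d + 1) → ℤ) :
    KTot (d := d) (Lc ^ (j + m)) (Lc ^ j) x' (((Lc ^ m : ℕ) : ℤ) • z') (Sum.inl κ) (Sum.inr μ)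
      = ((((Lc ^ j : ℕ) : ℝ)) ^ (d + 2))⁻¹ * ∑ i ∈ LegIdx d (Lc ^ j),
          wH (N := Lc ^ (j + m)) (d := d) κ μ (legPt (Lc ^ j) (Sum.inl κ : Fib d) x' i - ((Lc ^ (j + m) : ℕ) : ℤ) • z') := by
  rw [KTot_def, dec_inl_inr]
  congr 1
  refine Finset.sum_congr rfl fun i _ => ?_
  rw [zsmul_pow_mul, KInv_inl_inr_coarse]

/-- [folklore] **THE `(inr, inl)` BLOCK AT AN `Lc^m`-COARSE FIRST ARGUMENT IS MINUS THE TRANSPOSE** (`ℋ♭ = −ℋᵀ`: `dec_inr_inl`, `KInv_inr_inl_coarse`,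
`GamΦ_eq_neg_wH`). -/
theorem KTot_inr_inl_zsmul (j m : ℕ) (ν l : Fin (d + 1)) (w' y' : Fin (d + 1) → ℤ) :
    KTot (d := d) (Lc ^ (j + m)) (Lc ^ j) (((Lc ^ m : ℕ) : ℤ) • w') y' (Sum.inr ν) (Sum.inl l)
      = -(((((Lc ^ j : ℕ) : ℝ)) ^ (d + 2))⁻¹ * ∑ i' ∈ LegIdx d (Lc ^ j),
          wH (N := Lc ^ (j + m)) (d := d) l ν (legPt (Lc ^ j) (Sum.inl l : Fib d) y' i' - ((Lc ^ (j + m) : ℕ) : ℤ) • w')) := by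
  rw [KTot_def, dec_inr_inl, zsmul_pow_mul, ← mul_neg, ← Finset.sum_neg_distrib]
  congr 1
  refine Finset.sum_congr rfl fun i' _ => ?_
  rw [KInv_inr_inl_coarse, GamΦ_eq_neg_wH]

/-! ## §2 The decimated fine composite IS the step-`j` composite of the (j, m)-resolvents (field–field block) -/

/-- [folklore] **GENERIC: A COMPOSITE THROUGH A WEIGHTED LIFT AS A DOUBLE COARSE SUM** (an5's `compA_apply` skeleton for arbitrary kernels `A`, `B`,
lifted kernel `S`, factor `P`, slots `a`, `b`): `[A ∘ liftW P s t S ∘ B](x, y; a, b) = Σ'_{z′} Σ_μ A(x, P•z′; a, inr μ) ·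
Σ'_{w′} Σ_ν (slotW s · slotW t · S(z′, w′; slot s μ, slot t ν)) · B(P•w′, y; inr ν, b)` — the lift lives on the `(inr, inr)` slots of the
sublattice `P•ℤ^{d+1}`; the re-indexing of the two inner `tsum`s is unconditional (`tsum_sublattice₀`). -/
theorem comp_liftW_comp_apply (P : ℕ) [NeZero P] (sb tb : Bool) (A S B : MKer (d + 1) (Fib d)) (x y : Fin (d + 1) → ℤ) (a b : Fib d) :
    comp A (comp (liftW P sb tb S) B) x y a b
      = ∑' z' : (Fin (d + 1) → ℤ), ∑ μ : Fin (d + 1), A x ((P : ℤ) • z') a (Sum.inr μ)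
          * ∑' w' : (Fin (d + 1) → ℤ), ∑ ν : Fin (d + 1),
            (slotW d P sb * slotW d P tb * S z' w' (InterLevelTransport.slot sb μ) (InterLevelTransport.slot tb ν))
              * B ((P : ℤ) • w') y (Sum.inr ν) b := by
  unfold ExpKernelCalculus.comp
  refine tsum_sublattice₀ P _ _ (fun z hz => ?_) (fun z' => ?_)
  · simp only [liftW_off P sb tb _ (Or.inl hz), zero_mul, Finset.sum_const_zero, tsum_zero, mul_zero]
  · rw [Fintype.sum_sum_type]
    simp only [liftW_inl_left, zero_mul, Finset.sum_const_zero, tsum_zero, mul_zero, zero_add]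
    refine Finset.sum_congr rfl fun μ _ => ?_
    congr 1
    refine tsum_sublattice₀ P _ _ (fun w hw => ?_) (fun w' => ?_)
    · simp only [liftW_off P sb tb _ (Or.inr hw), zero_mul, Finset.sum_const_zero]
    · rw [Fintype.sum_sum_type]
      simp only [liftW_inl_right, zero_mul, Finset.sum_const_zero, zero_add, liftW_zsmul]

/-- [folklore] **THE DECIMATED FINE COMPOSITE IN CLOSED FORM** (field–field block; `N = Lc^(j+m)`, `N′ = Lc^(j+m+1)`):
`dec (Lc^j) [KInv_N ∘ liftW N true true (KInvStep Lc (j+m)) ∘ KInv_N](x′, y′; inl κ, inl l)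
 = −Σ'_{z′} Σ_μ KTot_{j,m}(x′, Lc^m•z′; inl κ, inr μ) · Σ'_{w′} Σ_ν GQ_{N′,N}(μ, z′; ν, w′) · ((Lc^j)^{−(d+2)} Σ_{i′} wH_N l ν (legPt y′ i′ − N•w′))`
— an5's `compA_apply` at every leg point, the FINITE leg sums exchanged with the absolutely convergent coarse sums (`summable_wH_sub_zsmul`, `GQ_bdd`,
`abs_tsum_finsum_mul_le`), then `KTot_inl_inr_zsmul`. -/
theorem dec_compA_apply (j m : ℕ) (x' y' : Fin (d + 1) → ℤ) (κ l : Fin (d + 1)) :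
    dec (Lc ^ j) (comp (KInv (N := Lc ^ (j + m)) (d := d))
        (comp (liftW (Lc ^ (j + m)) true true (KInvStep (d := d) Lc (j + m))) (KInv (N := Lc ^ (j + m)) (d := d))))
        x' y' (Sum.inl κ) (Sum.inl l)
      = -∑' z' : (Fin (d + 1) → ℤ), ∑ μ : Fin (d + 1), KTot (d := d) (Lc ^ (j + m)) (Lc ^ j) x' (((Lc ^ m : ℕ) : ℤ) • z') (Sum.inl κ) (Sum.inr μ)
          * ∑' w' : (Fin (d + 1) → ℤ), ∑ ν : Fin (d + 1), GQ (N := Lc ^ (j + m + 1)) (Lc ^ (j + m)) μ z' ν w'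
            * (((((Lc ^ j : ℕ) : ℝ)) ^ (d + 2))⁻¹ * ∑ i' ∈ LegIdx d (Lc ^ j),
                wH (N := Lc ^ (j + m)) (d := d) l ν (legPt (Lc ^ j) (Sum.inl l : Fib d) y' i' - ((Lc ^ (j + m) : ℕ) : ℤ) • w')) := by
  haveI : NeZero (Lc ^ (j + m)) := ⟨pow_ne_zero _ (NeZero.ne Lc)⟩
  obtain ⟨G₀, hG₀⟩ := GQ_bdd (N := Lc ^ (j + m + 1)) (d := d) (Lc ^ (j + m))
  -- shorthand-free names for the weight and the two column families
  have hQb : ∀ (q : Fin (d + 1) → ℤ) (μ : Fin (d + 1)) (z' : Fin (d + 1) → ℤ),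
      |∑' w', ∑ ν, GQ (N := Lc ^ (j + m + 1)) (Lc ^ (j + m)) μ z' ν w' * wH (N := Lc ^ (j + m)) (d := d) l ν (q - ((Lc ^ (j + m) : ℕ) : ℤ) • w')|
        ≤ G₀ * l1n Finset.univ (fun ν w' => wH (N := Lc ^ (j + m)) (d := d) l ν (q - ((Lc ^ (j + m) : ℕ) : ℤ) • w')) := by
    intro q μ z'
    rw [show (∑' w', ∑ ν, GQ (N := Lc ^ (j + m + 1)) (Lc ^ (j + m)) μ z' ν w' * wH (N := Lc ^ (j + m)) (d := d) l ν (q - ((Lc ^ (j + m) : ℕ) : ℤ) • w'))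
        = ∑' w', ∑ ν, wH (N := Lc ^ (j + m)) (d := d) l ν (q - ((Lc ^ (j + m) : ℕ) : ℤ) • w') * GQ (N := Lc ^ (j + m + 1)) (Lc ^ (j + m)) μ z' ν w'
      from tsum_congr fun w' => Finset.sum_congr rfl fun ν _ => mul_comm _ _]
    exact abs_tsum_finsum_mul_le Finset.univ (fun ν => summable_wH_sub_zsmul (Lc ^ (j + m)) l ν q) (fun ν w' => hG₀ μ z' ν w')
  -- expand `dec` on the field–field block and an5's closed form at every pair of leg points
  rw [ResolventCompositionStepB.dec_inl_inl]
  simp only [compA_apply]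
  -- (1) the right leg sum enters the inner coarse sum: `Σ_{i′} w · Inner(q_{i′}) = Inner′`
  have step1 : ∀ (μ : Fin (d + 1)) (z' : Fin (d + 1) → ℤ),
      ∑ i' ∈ LegIdx d (Lc ^ j), ((((Lc ^ j : ℕ) : ℝ)) ^ (d + 2))⁻¹
        * ∑' w', ∑ ν, GQ (N := Lc ^ (j + m + 1)) (Lc ^ (j + m)) μ z' ν w'
          * wH (N := Lc ^ (j + m)) (d := d) l ν (legPt (Lc ^ j) (Sum.inl l : Fib d) y' i' - ((Lc ^ (j + m) : ℕ) : ℤ) • w')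
      = ∑' w', ∑ ν, GQ (N := Lc ^ (j + m + 1)) (Lc ^ (j + m)) μ z' ν w'
          * (((((Lc ^ j : ℕ) : ℝ)) ^ (d + 2))⁻¹ * ∑ i' ∈ LegIdx d (Lc ^ j),
              wH (N := Lc ^ (j + m)) (d := d) l ν (legPt (Lc ^ j) (Sum.inl l : Fib d) y' i' - ((Lc ^ (j + m) : ℕ) : ℤ) • w')) := by
    intro μ z'
    rw [finsum_tsum_comm₁ (LegIdx d (Lc ^ j)) Finset.univ (fun _ => ((((Lc ^ j : ℕ) : ℝ)) ^ (d + 2))⁻¹)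
      (fun i' ν w' => GQ (N := Lc ^ (j + m + 1)) (Lc ^ (j + m)) μ z' ν w'
        * wH (N := Lc ^ (j + m)) (d := d) l ν (legPt (Lc ^ j) (Sum.inl l : Fib d) y' i' - ((Lc ^ (j + m) : ℕ) : ℤ) • w'))
      (fun i' ν _ => summable_mul_of_bdd (fun w' => hG₀ μ z' ν w') (summable_wH_sub_zsmul (Lc ^ (j + m)) l ν _))]
    refine tsum_congr fun w' => Finset.sum_congr rfl fun ν _ => ?_
    simp only [Finset.mul_sum]
    exact Finset.sum_congr rfl fun i' _ => by ring
  -- the bound on `Inner′`, uniform in `z′`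
  have hIb : ∀ (μ : Fin (d + 1)) (z' : Fin (d + 1) → ℤ),
      |∑' w', ∑ ν, GQ (N := Lc ^ (j + m + 1)) (Lc ^ (j + m)) μ z' ν w'
          * (((((Lc ^ j : ℕ) : ℝ)) ^ (d + 2))⁻¹ * ∑ i' ∈ LegIdx d (Lc ^ j),
              wH (N := Lc ^ (j + m)) (d := d) l ν (legPt (Lc ^ j) (Sum.inl l : Fib d) y' i' - ((Lc ^ (j + m) : ℕ) : ℤ) • w'))|
        ≤ ∑ i' ∈ LegIdx d (Lc ^ j), |((((Lc ^ j : ℕ) : ℝ)) ^ (d + 2))⁻¹|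
          * (G₀ * l1n Finset.univ (fun ν w' => wH (N := Lc ^ (j + m)) (d := d) l ν
              (legPt (Lc ^ j) (Sum.inl l : Fib d) y' i' - ((Lc ^ (j + m) : ℕ) : ℤ) • w'))) := by
    intro μ z'
    rw [← step1 μ z']
    refine (Finset.abs_sum_le_sum_abs _ _).trans (Finset.sum_le_sum fun i' _ => ?_)
    rw [abs_mul]
    exact mul_le_mul_of_nonneg_left (hQb _ μ z') (abs_nonneg _)
  -- (2) constants and signs: `Σ_i Σ_{i′} w·w·(−T i i′) = −Σ_i w·Σ_{i′} w·T i i′`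
  have eA : ∀ i : (Fin (d + 1) → ℕ) × ℕ,
      ∑ i' ∈ LegIdx d (Lc ^ j), ((((Lc ^ j : ℕ) : ℝ)) ^ (d + 2))⁻¹ * ((((Lc ^ j : ℕ) : ℝ)) ^ (d + 2))⁻¹
        * -(∑' z', ∑ μ, wH (N := Lc ^ (j + m)) (d := d) κ μ (legPt (Lc ^ j) (Sum.inl κ : Fib d) x' i - ((Lc ^ (j + m) : ℕ) : ℤ) • z')
          * ∑' w', ∑ ν, GQ (N := Lc ^ (j + m + 1)) (Lc ^ (j + m)) μ z' ν w'
            * wH (N := Lc ^ (j + m)) (d := d) l ν (legPt (Lc ^ j) (Sum.inl l : Fib d) y' i' - ((Lc ^ (j + m) : ℕ) : ℤ) • w'))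
      = -(((((Lc ^ j : ℕ) : ℝ)) ^ (d + 2))⁻¹ * ∑ i' ∈ LegIdx d (Lc ^ j), ((((Lc ^ j : ℕ) : ℝ)) ^ (d + 2))⁻¹
        * ∑' z', ∑ μ, wH (N := Lc ^ (j + m)) (d := d) κ μ (legPt (Lc ^ j) (Sum.inl κ : Fib d) x' i - ((Lc ^ (j + m) : ℕ) : ℤ) • z')
          * ∑' w', ∑ ν, GQ (N := Lc ^ (j + m + 1)) (Lc ^ (j + m)) μ z' ν w'
            * wH (N := Lc ^ (j + m)) (d := d) l ν (legPt (Lc ^ j) (Sum.inl l : Fib d) y' i' - ((Lc ^ (j + m) : ℕ) : ℤ) • w')) := by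
    intro i
    rw [Finset.mul_sum, ← Finset.sum_neg_distrib]
    exact Finset.sum_congr rfl fun i' _ => by ring
  simp only [eA]
  rw [Finset.sum_neg_distrib]
  congr 1
  -- (3) per left leg point: exchange the right leg sum with the outer coarse sum and fold `Inner′`
  have step3 : ∀ i : (Fin (d + 1) → ℕ) × ℕ,
      ∑ i' ∈ LegIdx d (Lc ^ j), ((((Lc ^ j : ℕ) : ℝ)) ^ (d + 2))⁻¹
        * ∑' z', ∑ μ, wH (N := Lc ^ (j + m)) (d := d) κ μ (legPt (Lc ^ j) (Sum.inl κ : Fib d) x' i - ((Lc ^ (j + m) : ℕ) : ℤ) • z')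
          * ∑' w', ∑ ν, GQ (N := Lc ^ (j + m + 1)) (Lc ^ (j + m)) μ z' ν w'
            * wH (N := Lc ^ (j + m)) (d := d) l ν (legPt (Lc ^ j) (Sum.inl l : Fib d) y' i' - ((Lc ^ (j + m) : ℕ) : ℤ) • w')
      = ∑' z', ∑ μ, wH (N := Lc ^ (j + m)) (d := d) κ μ (legPt (Lc ^ j) (Sum.inl κ : Fib d) x' i - ((Lc ^ (j + m) : ℕ) : ℤ) • z')
          * ∑' w', ∑ ν, GQ (N := Lc ^ (j + m + 1)) (Lc ^ (j + m)) μ z' ν w'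
            * (((((Lc ^ j : ℕ) : ℝ)) ^ (d + 2))⁻¹ * ∑ i' ∈ LegIdx d (Lc ^ j),
                wH (N := Lc ^ (j + m)) (d := d) l ν (legPt (Lc ^ j) (Sum.inl l : Fib d) y' i' - ((Lc ^ (j + m) : ℕ) : ℤ) • w')) := by
    intro i
    rw [finsum_tsum_comm₁ (LegIdx d (Lc ^ j)) Finset.univ (fun _ => ((((Lc ^ j : ℕ) : ℝ)) ^ (d + 2))⁻¹)
      (fun i' μ z' => wH (N := Lc ^ (j + m)) (d := d) κ μ (legPt (Lc ^ j) (Sum.inl κ : Fib d) x' i - ((Lc ^ (j + m) : ℕ) : ℤ) • z')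
        * ∑' w', ∑ ν, GQ (N := Lc ^ (j + m + 1)) (Lc ^ (j + m)) μ z' ν w'
          * wH (N := Lc ^ (j + m)) (d := d) l ν (legPt (Lc ^ j) (Sum.inl l : Fib d) y' i' - ((Lc ^ (j + m) : ℕ) : ℤ) • w'))
      (fun i' μ _ => summable_mul_of_bdd' (summable_wH_sub_zsmul (Lc ^ (j + m)) κ μ _) (fun z' => hQb _ μ z'))]
    refine tsum_congr fun z' => Finset.sum_congr rfl fun μ _ => ?_
    rw [← step1 μ z', Finset.mul_sum]
    exact Finset.sum_congr rfl fun i' _ => by ring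
  simp only [step3]
  -- (4) exchange the left leg sum with the outer coarse sum; the left leg sum IS the `(inl, inr)` block of `KTot`
  rw [finsum_tsum_comm₁ (LegIdx d (Lc ^ j)) Finset.univ (fun _ => ((((Lc ^ j : ℕ) : ℝ)) ^ (d + 2))⁻¹)
    (fun i μ z' => wH (N := Lc ^ (j + m)) (d := d) κ μ (legPt (Lc ^ j) (Sum.inl κ : Fib d) x' i - ((Lc ^ (j + m) : ℕ) : ℤ) • z')
      * ∑' w', ∑ ν, GQ (N := Lc ^ (j + m + 1)) (Lc ^ (j + m)) μ z' ν w'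
        * (((((Lc ^ j : ℕ) : ℝ)) ^ (d + 2))⁻¹ * ∑ i' ∈ LegIdx d (Lc ^ j),
            wH (N := Lc ^ (j + m)) (d := d) l ν (legPt (Lc ^ j) (Sum.inl l : Fib d) y' i' - ((Lc ^ (j + m) : ℕ) : ℤ) • w')))
    (fun i μ _ => summable_mul_of_bdd' (summable_wH_sub_zsmul (Lc ^ (j + m)) κ μ _) (fun z' => hIb μ z'))]
  refine tsum_congr fun z' => Finset.sum_congr rfl fun μ _ => ?_
  rw [KTot_inl_inr_zsmul, Finset.mul_sum, Finset.sum_mul]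
  exact Finset.sum_congr rfl fun i _ => by ring

/-- [folklore] **THE DECIMATED FINE COMPOSITE IS `((Lc^j)^(d+2))²` TIMES THE STEP-`j` COMPOSITE OF THE (j, m)-RESOLVENTS** (field–field block):
`dec (Lc^j) [KInv_N ∘ liftW N true true (KInvStep Lc (j+m)) ∘ KInv_N](x′,y′; inl κ, inl l)
 = ((Lc^j)^(d+2))² · [KTot_{j,m} ∘ liftW (Lc^m) true true (KInvStep Lc (j+m)) ∘ KTot_{j,m}](x′,y′; inl κ, inl l)` (`N = Lc^(j+m)`):
both sides in closed form (`dec_compA_apply`, `comp_liftW_comp_apply` + `KTot_inr_inl_zsmul`), an5's `KInvStep_inl_inl` for `GQ = (N^(d+2))²·KInvStep`,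
and `N^(d+2) = (Lc^j)^(d+2)·(Lc^m)^(d+2)`. -/
theorem dec_compA_eq_comp_KTot (j m : ℕ) (x' y' : Fin (d + 1) → ℤ) (κ l : Fin (d + 1)) :
    dec (Lc ^ j) (comp (KInv (N := Lc ^ (j + m)) (d := d))
        (comp (liftW (Lc ^ (j + m)) true true (KInvStep (d := d) Lc (j + m))) (KInv (N := Lc ^ (j + m)) (d := d))))
        x' y' (Sum.inl κ) (Sum.inl l)
      = ((((Lc ^ j : ℕ) : ℝ)) ^ (d + 2) * (((Lc ^ j : ℕ) : ℝ)) ^ (d + 2))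
        * comp (KTot (d := d) (Lc ^ (j + m)) (Lc ^ j))
            (comp (liftW (Lc ^ m) true true (KInvStep (d := d) Lc (j + m))) (KTot (d := d) (Lc ^ (j + m)) (Lc ^ j)))
            x' y' (Sum.inl κ) (Sum.inl l) := by
  haveI : NeZero (Lc ^ m) := ⟨pow_ne_zero _ (NeZero.ne Lc)⟩
  have hLj : (((Lc ^ j : ℕ) : ℝ)) ^ (d + 2) ≠ 0 := pow_ne_zero _ (by exact_mod_cast pow_ne_zero _ (NeZero.ne Lc))
  have hLm : (((Lc ^ m : ℕ) : ℝ)) ^ (d + 2) ≠ 0 := pow_ne_zero _ (by exact_mod_cast pow_ne_zero _ (NeZero.ne Lc))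
  have hN : (((Lc ^ (j + m) : ℕ) : ℝ)) ^ (d + 2) = (((Lc ^ j : ℕ) : ℝ)) ^ (d + 2) * (((Lc ^ m : ℕ) : ℝ)) ^ (d + 2) := by
    rw [← mul_pow]; push_cast; rw [← pow_add]
  rw [dec_compA_apply, comp_liftW_comp_apply]
  simp only [slot_true, slotW_true, KInvStep_inl_inl, KTot_inr_inl_zsmul]
  rw [← tsum_neg, ← tsum_mul_left]
  refine tsum_congr fun z' => ?_
  rw [Finset.mul_sum, ← Finset.sum_neg_distrib]
  refine Finset.sum_congr rfl fun μ _ => ?_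
  have key : (∑' w', ∑ ν, (((Lc ^ m : ℕ) : ℝ)) ^ (d + 2) * (((Lc ^ m : ℕ) : ℝ)) ^ (d + 2)
        * (((((Lc ^ (j + m) : ℕ) : ℝ)) ^ (d + 2))⁻¹ * (((((Lc ^ (j + m) : ℕ) : ℝ)) ^ (d + 2))⁻¹
          * GQ (N := Lc ^ (j + m + 1)) (Lc ^ (j + m)) μ z' ν w'))
        * -(((((Lc ^ j : ℕ) : ℝ)) ^ (d + 2))⁻¹ * ∑ i' ∈ LegIdx d (Lc ^ j),
            wH (N := Lc ^ (j + m)) (d := d) l ν (legPt (Lc ^ j) (Sum.inl l : Fib d) y' i' - ((Lc ^ (j + m) : ℕ) : ℤ) • w')))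
      = -(((((Lc ^ m : ℕ) : ℝ)) ^ (d + 2) * (((Lc ^ m : ℕ) : ℝ)) ^ (d + 2)
          * (((((Lc ^ (j + m) : ℕ) : ℝ)) ^ (d + 2))⁻¹ * ((((Lc ^ (j + m) : ℕ) : ℝ)) ^ (d + 2))⁻¹))
        * ∑' w', ∑ ν, GQ (N := Lc ^ (j + m + 1)) (Lc ^ (j + m)) μ z' ν w'
          * (((((Lc ^ j : ℕ) : ℝ)) ^ (d + 2))⁻¹ * ∑ i' ∈ LegIdx d (Lc ^ j),
              wH (N := Lc ^ (j + m)) (d := d) l ν (legPt (Lc ^ j) (Sum.inl l : Fib d) y' i' - ((Lc ^ (j + m) : ℕ) : ℤ) • w'))) := by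
    rw [← tsum_mul_left, ← tsum_neg]
    refine tsum_congr fun w' => ?_
    rw [Finset.mul_sum, ← Finset.sum_neg_distrib]
    exact Finset.sum_congr rfl fun ν _ => by ring
  rw [key, hN]
  field_simp


/-- [folklore] **THE STEP-`j` COMPOSITE IS «H C Hᵀ» WITH A MINUS SIGN** (both outer factors written as the `(inl, inr)` = minimiser-type block of
the (j, m)-resolvent; `ℋ♭ = −ℋᵀ` on the right leg): `[KTot_{j,m} ∘ liftW (Lc^m) true true (KInvStep Lc (j+m)) ∘ KTot_{j,m}](x′, y′; inl κ, inl l)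
= −Σ'_{z′} Σ_μ KTot_{j,m}(x′, Lc^m•z′; inl κ, inr μ) · Σ'_{w′} Σ_ν ((Lc^m)^(d+2))²·KInvStep Lc (j+m) (z′, w′; inl μ, inl ν) · KTot_{j,m}(y′, Lc^m•w′; inl l, inr ν)`. -/
theorem comp_KTot_liftW_apply (j m : ℕ) (x' y' : Fin (d + 1) → ℤ) (κ l : Fin (d + 1)) :
    comp (KTot (d := d) (Lc ^ (j + m)) (Lc ^ j))
        (comp (liftW (Lc ^ m) true true (KInvStep (d := d) Lc (j + m))) (KTot (d := d) (Lc ^ (j + m)) (Lc ^ j)))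
        x' y' (Sum.inl κ) (Sum.inl l)
      = -∑' z' : (Fin (d + 1) → ℤ), ∑ μ : Fin (d + 1), KTot (d := d) (Lc ^ (j + m)) (Lc ^ j) x' (((Lc ^ m : ℕ) : ℤ) • z') (Sum.inl κ) (Sum.inr μ)
          * ∑' w' : (Fin (d + 1) → ℤ), ∑ ν : Fin (d + 1),
            ((((Lc ^ m : ℕ) : ℝ)) ^ (d + 2) * (((Lc ^ m : ℕ) : ℝ)) ^ (d + 2) * KInvStep (d := d) Lc (j + m) z' w' (Sum.inl μ) (Sum.inl ν))
              * KTot (d := d) (Lc ^ (j + m)) (Lc ^ j) y' (((Lc ^ m : ℕ) : ℤ) • w') (Sum.inl l) (Sum.inr ν) := by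
  haveI : NeZero (Lc ^ m) := ⟨pow_ne_zero _ (NeZero.ne Lc)⟩
  rw [comp_liftW_comp_apply, ← tsum_neg]
  refine tsum_congr fun z' => ?_
  rw [← Finset.sum_neg_distrib]
  refine Finset.sum_congr rfl fun μ _ => ?_
  rw [← mul_neg, ← tsum_neg]
  congr 1
  refine tsum_congr fun w' => ?_
  rw [← Finset.sum_neg_distrib]
  refine Finset.sum_congr rfl fun ν _ => ?_
  simp only [slot_true, slotW_true]
  rw [KTot_inr_inl_zsmul, KTot_inl_inr_zsmul]
  ring

/-! ## §3 The finite-level (MS-1) with the composite over the (j, m)-resolvents -/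

/-- [folklore] **THE FINITE-LEVEL (MS-1), K-SIDE, TRANSVERSE — «Γ_{(j,m+1)} = Γ_{(j,m)} + H_{(j,m)} C H_{(j,m)}ᵀ» AT EVERY `j`.**  For every `Lc ≥ 1`,
`j, m` and all finitely supported CO-CLOSED test 1-forms `G, G′` on the step-`j` lattice,
`⟨G, [KTot (Lc^(j+m+1)) (Lc^j)]_ff G′⟩ = ⟨G, ([KTot (Lc^(j+m)) (Lc^j)] − ((Lc^j)^(d+2))²·[KTot_{j,m} ∘ liftW (Lc^m) true true (KInvStep Lc (j+m)) ∘ KTot_{j,m}])_ff G′⟩`: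
the (j, m+1)-resolvent's covariance is the (j, m)-resolvent's plus the (j, m)-minimisers sandwiching THE NEXT ONE STEP `KInvStep Lc (j+m)` (the
(j+m, 1)-member, lifted by `Lc^m` in step-`j` coordinates; the `(inr, inl)` block carries the sign, `ℋ♭ = −ℋᵀ`), on the gauge-transverse slice,
EXACTLY; the scalar `((Lc^j)^(d+2))²` is the unit factor of the two multiplier legs (`PerfectTelescopingFinite.kTot_pair_telescoping` +
`dec_compA_eq_comp_KTot`).  As `j → ∞` in the road's units this is the shape of N7 PLAN (MS-1); that limit is NOT taken here. -/
theorem kTot_pair_telescoping_step (j m : ℕ) (G G' : Form1 (d + 1) ℝ)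
    (hG : ∀ κ, (Function.support (G κ)).Finite) (hG' : ∀ κ, (Function.support (G' κ)).Finite)
    (hcoG : codiff₁ G = 0) (hcoG' : codiff₁ G' = 0) :
    (∑' x', ∑' y', ∑ κ, ∑ l, G κ x' * KTot (d := d) (Lc ^ (j + m + 1)) (Lc ^ j) x' y' (Sum.inl κ) (Sum.inl l) * G' l y')
      = ∑' x', ∑' y', ∑ κ, ∑ l, G κ x' *
          (KTot (d := d) (Lc ^ (j + m)) (Lc ^ j) x' y' (Sum.inl κ) (Sum.inl l)
            - ((((Lc ^ j : ℕ) : ℝ)) ^ (d + 2) * (((Lc ^ j : ℕ) : ℝ)) ^ (d + 2))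
              * comp (KTot (d := d) (Lc ^ (j + m)) (Lc ^ j))
                  (comp (liftW (Lc ^ m) true true (KInvStep (d := d) Lc (j + m))) (KTot (d := d) (Lc ^ (j + m)) (Lc ^ j)))
                  x' y' (Sum.inl κ) (Sum.inl l)) * G' l y' := by
  rw [kTot_pair_telescoping Lc j m G G' hG hG' hcoG hcoG']
  simp only [dec_compA_eq_comp_KTot]

end Summit.QuantumFields.BalabanUV.Beta.FP.PerfectTelescopingFiniteComposite

end
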